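import Summits.BirchSwinnertonDyer.BirchSwinnertonDyer.Theorems.QuadraticBranchSignedControlPlusEtaNonsurjConjADoorUnitBSD
import Summits.BirchSwinnertonDyer.BirchSwinnertonDyer.Theorems.QuadraticBranchSignedControlPlusEtaNonsurjConjADoorMinusRecords
import Summits.BirchSwinnertonDyer.BirchSwinnertonDyer.Theorems.QuadraticBranchSignedControlPlusEtaNonsurjConjADoorEigenRecords
import Summits.BirchSwinnertonDyer.BirchSwinnertonDyer.Theorems.QuadraticBranchSignedControlPlusEtaNonsurjConjADoorHeckeRecordsA
import Summits.BirchSwinnertonDyer.Rank1Residual.Additive.QuadraticBranchPeriodRatioOfNamedFact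
import Summits.BirchSwinnertonDyer.Rank1Residual.Additive.QuadraticBranchOddStrictExactControlDischarge
import Summits.BirchSwinnertonDyer.Rank1Residual.Additive.SignedTwistOddBranchReadings
import HarnessLib

/-!
# Route `QuadraticBranchSignedControl` (rung K8, cell `bsd-potss`), residual crux `PlusEtaMainConjectureNonsurj`
# (stmt-BirchSwinnertonDyer-19606): `BSD_p` ON THE PRIME-`L` RANK-ONE ROWS, PER ROW — `BSDp W p` from (C1⁺_η)(V) modulo the route's declared
# residual C-cc-1 AT THE ROW and Kobayashi Thm. 7.4 (seat `bsd-potss-k8eta-c2` g22, sequel of `…ConjADoorUnitBSD`)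

WHY. The companion file reaches `MissingPPartAt W p` on rank-ZERO rows from the `η`-form (C1⁺_η)(V) with NO open crux. On rank-ONE rows ctrl g3's
pair theorem runs x1b's chain `LevelBridge.bsdp_of_plusMC_of_pAdicGrossZagierValuation_of_readings_of_periodRatio`: it needs, at the row, the
`F`-form (C1_η) (from the `η`-form by k8eta-c1's seam + Thm. 1.2), (R2⁻) (Kitajima–Otsuki, sign `−`), the exact odd reading (Kobayashi Thm. 7.4 at
`η`, named fact `thm74_etaEvenMC_iff_etaOddMC`, through the route's PROVED layer comparison: `etaTransportSigned_of_thm74`), Poitou–Tate (tree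
theorem), Gross–Zagier I (7.3), GZK, modularity, newforms, Mazur's period ratio — and the route's DECLARED RESIDUAL crux 19116 `PAdicGrossZagierBranch`
(C-cc-1, the regulator-free `δ = 0` valuation law for the leading coefficient of `L_p⁻(V,η,X)/X`) AT THIS ROW:
`QuadraticBranchMinusLeadingValuationAt W p 0`, DISPLAYED. So the prime-`L` rank-one records of g20/g21 (69 in-table rows, the six UNCONGRUENT rows
u5a:−4, −23, 37, −47, −67, −71) are ONE displayed per-row instance of C-cc-1 away from `BSDp W p` in the kernel.

WHAT. §1 `bsdp_of_plusEtaMainConjectureAt_of_analyticRank_eq_one` (per-row rank-1 assembly from the `η`-form; conclusion `BSDp W p`, hence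
`MissingPPartAt W p` by `missingPPartAt_of_bsdp`). §2 compositions with the prime-`L` record shapes of the three class-group doors:
`bsdp_r1_of_relClassNumber` (L6⁻, p703871's `etaMC_r1_of_relClassNumber`), `bsdp_r1_of_eigenHom` (L2, p708181), `bsdp_r1_of_heckeEigenHom` (L4, p707571).

HONEST FRAMING (cell `bsd-potss`; FULL-BSD rank ≤ 1 programme, HUMAN RULING D-0036/D-0074): TOOL THEOREMS ONLY — no definition, no named fact, no
`sorry`, axioms standard; CONDITIONAL on the displayed named facts (`hGZK hmod hnf hM h12 hKO hGZ h74 h22 h41 h6273`, hypothesis position) AND on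
the displayed per-row instance `hcc1 : QuadraticBranchMinusLeadingValuationAt W p 0` of the route's OPEN crux C-cc-1 (item 19116; open class-wide;
at a row it is a numerical statement about `coeff₁ L_p⁻`, the `p`-divisibility level of the generator, `#Ш_an·Tam/#tors²` — NOT certified here).
No stub of 19606 is proved; the crux and the route stay OPEN; nothing is booked; `BSD(W,p)` is ASSERTED for no pair. `--supports stmt-BirchSwinnertonDyer-19606`.

References: [Kobayashi2003] Thm. 1.2, 2.2, §4 + Thm. 4.1, Thm. 6.2–7.4, Thm. 9.3; [KitajimaOtsuki2018] Main Thm. 1.3; [Mazur1978] Cor. 4.1;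
[GrossZagier1986] Thm. I.(7.3); [Kobayashi2013] (p-adic Gross–Zagier; shape of C-cc-1); [MilneADT2006] I Thm. 4.10; [Miller2011LMS] Def. 1.1;
[CoatesSujatha2005] §3 (A).
-/

set_option autoImplicit false
set_option linter.dupNamespace false
noncomputable section

open scoped Classical MatrixGroups ModularForm nonZeroDivisors

open CongruenceSubgroup NumberField IsDedekindDomain Field WeierstrassCurve
open Literature.NumberTheory.EllipticCurves Literature.NumberTheory.EllipticCurves.ModularForms
  Literature.NumberTheory.EllipticCurves.Rank1Residual Literature.NumberTheory.EllipticCurves.Rank1Residual.Typed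
  Literature.NumberTheory.GaloisRepresentations Literature.NumberTheory.GaloisCohomology Literature.NumberTheory.NumberFields
  Literature.NumberTheory.EllipticCurves.GreenbergVatsal2000 ZpExtension
open Summit.BirchSwinnertonDyer.Rank1Residual Summit.BirchSwinnertonDyer.Rank1Residual.Additive
open Summit.BirchSwinnertonDyer.BirchSwinnertonDyer.Theorems

namespace Summit.BirchSwinnertonDyer.BirchSwinnertonDyer.Theorems.EtaConjADoorBSDRankOne

variable (W : WeierstrassCurve ℚ) [W.IsElliptic] [W.IsGloballyMinimal] (p : ℕ) [hp : Fact p.Prime]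

/-! ## §1 Per-row rank-1 assembly from the `η`-form (C1⁺_η)(V), modulo C-cc-1 at the row -/

/-- **`BSDp W p` on a rank-ONE Gss2 pair from (C1⁺_η) at the twin and C-cc-1 at the row.** `W` globally minimal, `p ≥ 5`, `V` a globally minimal
model of `W^{(p*)}` good at `p` with `a_p(V) = 0`, `r_an(W) = 1`, Kobayashi's even main conjecture at `η` for `(V,p)` (print currency), and the
route's crux C-cc-1 AT THIS ROW (`QuadraticBranchMinusLeadingValuationAt W p 0`, displayed). Named facts (hypothesis position): GZK, modularity,
newforms, Mazur's `p ∤ c₀`, Kobayashi Thm. 1.2 (the `η → F` seam), Kitajima–Otsuki Thm. 1.3 ((R2⁻) on `W`'s strict minus duals as in the route's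
`closes`), Gross–Zagier I (7.3), Kobayashi Thm. 7.4 at `η` (the exact odd reading through the route's PROVED layer comparison,
`etaTransportSigned_of_thm74`); Poitou–Tate is a tree theorem. Then x1b's chain `LevelBridge.bsdp_of_plusMC_of_pAdicGrossZagierValuation_of_readings_of_periodRatio`.
CONDITIONAL; nothing booked. [cite: Kobayashi2003, Thm. 1.2 (p. 2), Thm. 7.4 (p. 13), Thm. 9.3 (p. 26)] [cite: KitajimaOtsuki2018, Main Thm. 1.3]
[cite: GrossZagier1986, Thm. I.(7.3) (p. 230)] [cite: Mazur1978, Cor. 4.1] [cite: Miller2011LMS, §1 and Def. 1.1] -/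
theorem bsdp_of_plusEtaMainConjectureAt_of_analyticRank_eq_one
    (hGZK : rank_eq_analyticRank_of_analyticRank_le_one) (hmod : hasEntireLFunction_rat)
    (hnf : exists_isNewformOf) (hM : mazur_not_dvd_maninConstant_of_odd)
    (h12 : Kobayashi2003.thm12_signedSelmerDual_finite_torsion)
    (hKO : KitajimaOtsuki2018.mainThm13_etaSignedSelmerDual_noFiniteSubmodule)
    (hGZ : GrossZagier1986_thm_I_7_3) (h74 : Kobayashi2003.thm74_etaEvenMC_iff_etaOddMC)
    (hp5 : 5 ≤ p) (V : WeierstrassCurve ℚ) [V.IsElliptic] [V.IsGloballyMinimal] (C : VariableChange ℚ)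
    (hCV : C • W.quadraticTwist ((-1) ^ (p / 2) * p) = V)
    (hgood : V.HasGoodReductionAtPrime p) (hap : V.frobeniusTrace p = 0)
    (hη : QuadraticBranchPlusEtaMainConjectureAt V p) (hr1 : W.analyticRank = 1)
    (hcc1 : QuadraticBranchMinusLeadingValuationAt W p 0) :
    BSDp W p := by
  -- `η`-form ⟹ `F`-form (C1_η) at the twin
  have h1 : QuadraticBranchPlusMainConjectureAt V p :=
    PlusMCBranchCMRung.plusMainConjectureAt_of_plusEtaMainConjectureAt h12 hp5 hgood hap hη
  -- (R2⁻) at `W`: Kitajima–Otsuki Thm. 1.3 (sign `−`, the `m = −1` clause), repackaged as in the route's `closes`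
  have hR2 : OddBranchStrictMinusNoFiniteSubmoduleAt W p :=
    SignedTwist.oddBranchStrictMinusNoFiniteSubmoduleAt_of_kitajimaOtsuki13MinusEta W p
      fun K₀ _ _ _ _ ηq hηK V' _ _ hp2' hgood' hap' κ γ hκ hγ hγK D hfin htor M hM' =>
        hKO p K₀ ηq hηK V' hp2' hgood' hap' κ γ hκ hγ hγK (-1)
          { X := D.X
            addCommGroup := D.addCommGroup
            module := D.module
            conj_mem := D.conj_mem
            toDual := D.toDual
            bijective := D.bijective
            toDual_T_smul := D.toDual_T_smul
            toDual_C_smul := D.toDual_C_smul }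
          hfin htor M hM'
  exact LevelBridge.bsdp_of_plusMC_of_pAdicGrossZagierValuation_of_readings_of_periodRatio W p hmod hGZ hGZK
    (SchneiderFreeAdditiveX3.PoitouTateReduction.poitouTate_selmerStructure_duality_real_holds ℚ) hnf
    (periodRatio_of_mazur p hM hp5) hR2
    (LevelBridge.exactOddBranchReading_of_kobayashi74OddEtaExact W p ((etaTransportSigned_of_thm74 h74).2 p hp5))
    ((quadraticBranchPAdicGrossZagierValuationAt_iff W p).mpr hcc1) hp5 hCV hgood hap h1 hr1

/-- **`MissingPPartAt W p` on a rank-ONE Gss2 pair** — `ord_p #Ш(W) = ord_p #Ш_an(W)` — from §1 (`Ш(W)` finite by GZK in analytic rank one).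
[cite: Miller2011LMS, §1 and Def. 1.1] [cite: Kobayashi2003, Thm. 9.3 (p. 26)] -/
theorem missingPPartAt_of_plusEtaMainConjectureAt_of_analyticRank_eq_one
    (hGZK : rank_eq_analyticRank_of_analyticRank_le_one) (hmod : hasEntireLFunction_rat)
    (hnf : exists_isNewformOf) (hM : mazur_not_dvd_maninConstant_of_odd)
    (h12 : Kobayashi2003.thm12_signedSelmerDual_finite_torsion)
    (hKO : KitajimaOtsuki2018.mainThm13_etaSignedSelmerDual_noFiniteSubmodule)
    (hGZ : GrossZagier1986_thm_I_7_3) (h74 : Kobayashi2003.thm74_etaEvenMC_iff_etaOddMC)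
    (hp5 : 5 ≤ p) (V : WeierstrassCurve ℚ) [V.IsElliptic] [V.IsGloballyMinimal] (C : VariableChange ℚ)
    (hCV : C • W.quadraticTwist ((-1) ^ (p / 2) * p) = V)
    (hgood : V.HasGoodReductionAtPrime p) (hap : V.frobeniusTrace p = 0)
    (hη : QuadraticBranchPlusEtaMainConjectureAt V p) (hr1 : W.analyticRank = 1)
    (hcc1 : QuadraticBranchMinusLeadingValuationAt W p 0) :
    MissingPPartAt W p := by
  haveI : Finite W.sha := (hGZK W (by omega)).2
  exact missingPPartAt_of_bsdp W p (bsdp_of_plusEtaMainConjectureAt_of_analyticRank_eq_one W p hGZK hmod hnf hM h12 hKO hGZ h74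
    hp5 V C hCV hgood hap hη hr1 hcc1)

/-! ## §2 Through the prime-`L` record shapes of the class-group doors -/

/-- **`BSDp W p` on a prime-`L` rank-one row from the RELATIVE class-number datum** (door L6⁻; the shape of the UNCONGRUENT rows u5a:−4, −23, 37,
−47 and of g21's CM rank-one L6⁻ rows at `p = 5`): p703871's `EtaConjADoorMinusRecords.etaMC_r1_of_relClassNumber` (inputs `h22 h41 h6273 hGZK`,
`r_an(W) = 1`, the tower clause, `(L_p⁺(V,η,X)) = (X)`, the datum) then §1 (+ `hmod hnf hM h12 hKO hGZ h74` and C-cc-1 at the row). CONDITIONAL;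
nothing booked. [cite: Kobayashi2003, §4 (p. 8), Thm. 7.4, Thm. 9.3] [cite: CoatesSujatha2005, §3 (A) and Thm. 3.4] [cite: Miller2011LMS, Def. 1.1] -/
theorem bsdp_r1_of_relClassNumber
    (hGZK : rank_eq_analyticRank_of_analyticRank_le_one) (hmod : hasEntireLFunction_rat)
    (hnf : exists_isNewformOf) (hM : mazur_not_dvd_maninConstant_of_odd)
    (h12 : Kobayashi2003.thm12_signedSelmerDual_finite_torsion)
    (hKO : KitajimaOtsuki2018.mainThm13_etaSignedSelmerDual_noFiniteSubmodule)
    (hGZ : GrossZagier1986_thm_I_7_3) (h74 : Kobayashi2003.thm74_etaEvenMC_iff_etaOddMC)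
    (h22 : Kobayashi2003.thm22_etaSignedSelmerDual_finite_torsion)
    (h41 : Kobayashi2003.thm41_plusEtaCharIdeal_dvd)
    (h6273 : Kobayashi2003.thm62_63_73_etaColemanPoitouTate)
    [NeZero p] (hp5 : 5 ≤ p) (hr1 : W.analyticRank = 1)
    (V : WeierstrassCurve ℚ) [V.IsElliptic] [V.IsGloballyMinimal] (C : VariableChange ℚ)
    (hC : C • W.quadraticTwist ((-1) ^ (p / 2) * p) = V)
    (hgood : V.HasGoodReductionAtPrime p) (hap : V.frobeniusTrace p = 0)
    (hns : ¬ ∀ m : ℕ, V.HasSurjectiveModNGaloisRep (p ^ m : ℕ))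
    (hX : ∀ {N : ℕ} [NeZero N] {f : CuspForm (Gamma0 N) 2}, IsNewformOf V f →
      ∀ (ϖ : ℚ), (if Even (p / 2) then (ϖ : ℝ) * V.realPeriodRat = plusPeriod f
          else (ϖ : ℝ) * V.imaginaryPeriodRat = minusPeriod f) →
      ∀ (Lη : IwasawaAlgebra p), IsQuadraticBranchPlusLFunction f p ϖ Lη →
        Ideal.span {Lη} = Ideal.span {(PowerSeries.X : IwasawaAlgebra p)})
    (hP : haveI : NumberField (W.divisionField p) := NumberField.mk
      ∃ P : geomTorsion W (p : ℤ), P ≠ 0 ∧ ∀ τ : absoluteGaloisGroup ℚ, τ • P = -P →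
        ∀ K : IntermediateField ℚ (W.divisionField p),
          K = IntermediateField.fixedField
            ((MulAction.stabilizer (absoluteGaloisGroup ℚ) P).map (absRestrictNormalHom (W.divisionField p))) →
        ∀ σ : K ≃ₐ[ℚ] K,
          (∀ x : K, absRestrictNormalHom (W.divisionField p) τ (x : W.divisionField p) =
            ((σ x : K) : W.divisionField p)) →
          padicValNat p (NumberField.classNumber K) ≤
            padicValNat p (NumberField.classNumber (IntermediateField.fixedField (Subgroup.zpowers σ))))
    (hcc1 : QuadraticBranchMinusLeadingValuationAt W p 0) :
    BSDp W p :=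
  bsdp_of_plusEtaMainConjectureAt_of_analyticRank_eq_one W p hGZK hmod hnf hM h12 hKO hGZ h74 hp5 V C hC hgood hap
    (EtaConjADoorMinusRecords.etaMC_r1_of_relClassNumber h22 h41 h6273 hGZK p hp5 W hr1 V C hC hgood hap hns hX hP) hr1 hcc1

/-- **`BSDp W p` on a prime-`L` rank-one row from the plain tautological eigen-test** (door L2; the shape of the UNCONGRUENT rows u5a:−67, −71):
p708181's `EtaConjADoorEigenRecords.etaMC_r1_of_eigenHom` then §1. CONDITIONAL; nothing booked. [cite: Kobayashi2003, §4 (p. 8), Thm. 7.4, Thm. 9.3]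
[cite: CoatesSujatha2005, §3 (A) and Thm. 3.4] [cite: DeoRaySujatha2023, §3 Thm. 3.8 (c2) (arXiv:2202.09937 p. 9)] [cite: Miller2011LMS, Def. 1.1] -/
theorem bsdp_r1_of_eigenHom
    (hGZK : rank_eq_analyticRank_of_analyticRank_le_one) (hmod : hasEntireLFunction_rat)
    (hnf : exists_isNewformOf) (hM : mazur_not_dvd_maninConstant_of_odd)
    (h12 : Kobayashi2003.thm12_signedSelmerDual_finite_torsion)
    (hKO : KitajimaOtsuki2018.mainThm13_etaSignedSelmerDual_noFiniteSubmodule)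
    (hGZ : GrossZagier1986_thm_I_7_3) (h74 : Kobayashi2003.thm74_etaEvenMC_iff_etaOddMC)
    (h22 : Kobayashi2003.thm22_etaSignedSelmerDual_finite_torsion)
    (h41 : Kobayashi2003.thm41_plusEtaCharIdeal_dvd)
    (h6273 : Kobayashi2003.thm62_63_73_etaColemanPoitouTate)
    [NeZero p] (hp5 : 5 ≤ p) (hr1 : W.analyticRank = 1)
    (V : WeierstrassCurve ℚ) [V.IsElliptic] [V.IsGloballyMinimal] (C : VariableChange ℚ)
    (hC : C • W.quadraticTwist ((-1) ^ (p / 2) * p) = V)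
    (hgood : V.HasGoodReductionAtPrime p) (hap : V.frobeniusTrace p = 0)
    (hns : ¬ ∀ m : ℕ, V.HasSurjectiveModNGaloisRep (p ^ m : ℕ))
    (hX : ∀ {N : ℕ} [NeZero N] {f : CuspForm (Gamma0 N) 2}, IsNewformOf V f →
      ∀ (ϖ : ℚ), (if Even (p / 2) then (ϖ : ℝ) * V.realPeriodRat = plusPeriod f
          else (ϖ : ℝ) * V.imaginaryPeriodRat = minusPeriod f) →
      ∀ (Lη : IwasawaAlgebra p), IsQuadraticBranchPlusLFunction f p ϖ Lη →
        Ideal.span {Lη} = Ideal.span {(PowerSeries.X : IwasawaAlgebra p)})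
    (hP : haveI : NumberField (W.divisionField p) := NumberField.mk
      ∃ P : geomTorsion W (p : ℤ), P ≠ 0 ∧
        ∀ K : IntermediateField ℚ (W.divisionField p),
          K = IntermediateField.fixedField
            ((MulAction.stabilizer (absoluteGaloisGroup ℚ) P).map (absRestrictNormalHom (W.divisionField p))) →
        ∀ μ : Additive (ClassGroup (𝓞 K)) →+ ZMod p,
          (∀ (τ : absoluteGaloisGroup ℚ) (σ : K ≃ₐ[ℚ] K) (a : ℕ),
              (∀ x : K, absRestrictNormalHom (W.divisionField p) τ (x : W.divisionField p) =
                ((σ x : K) : W.divisionField p)) → τ • P = a • P →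
              ∀ (I J : (Ideal (𝓞 K))⁰),
                (J : Ideal (𝓞 K)) = (I : Ideal (𝓞 K)).map (AmbiguousClass.intAut σ : 𝓞 K →+* 𝓞 K) →
                μ (Additive.ofMul (ClassGroup.mk0 J)) = a • μ (Additive.ofMul (ClassGroup.mk0 I))) →
          μ = 0)
    (hcc1 : QuadraticBranchMinusLeadingValuationAt W p 0) :
    BSDp W p :=
  bsdp_of_plusEtaMainConjectureAt_of_analyticRank_eq_one W p hGZK hmod hnf hM h12 hKO hGZ h74 hp5 V C hC hgood hap
    (EtaConjADoorEigenRecords.etaMC_r1_of_eigenHom h22 h41 h6273 hGZK p hp5 W hr1 V C hC hgood hap hns hX hP) hr1 hcc1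

/-- **`BSDp W p` on a prime-`L` rank-one row from the Hecke-refined eigen datum ALONE** (door L4, `hVH`-free): p707571's
`EtaConjADoorHeckeRecords.etaMC_r1_of_heckeEigenHom` then §1. CONDITIONAL; nothing booked. [cite: Kobayashi2003, §4 (p. 8), Thm. 7.4, Thm. 9.3]
[cite: CoatesSujatha2005, §3 (A) and Thm. 3.4] [cite: DeoRaySujatha2023, §3 Thm. 3.8 (c2) and the definition of H′_L (arXiv:2202.09937 p. 9)]
[cite: Miller2011LMS, Def. 1.1] -/
theorem bsdp_r1_of_heckeEigenHom
    (hGZK : rank_eq_analyticRank_of_analyticRank_le_one) (hmod : hasEntireLFunction_rat)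
    (hnf : exists_isNewformOf) (hM : mazur_not_dvd_maninConstant_of_odd)
    (h12 : Kobayashi2003.thm12_signedSelmerDual_finite_torsion)
    (hKO : KitajimaOtsuki2018.mainThm13_etaSignedSelmerDual_noFiniteSubmodule)
    (hGZ : GrossZagier1986_thm_I_7_3) (h74 : Kobayashi2003.thm74_etaEvenMC_iff_etaOddMC)
    (h22 : Kobayashi2003.thm22_etaSignedSelmerDual_finite_torsion)
    (h41 : Kobayashi2003.thm41_plusEtaCharIdeal_dvd)
    (h6273 : Kobayashi2003.thm62_63_73_etaColemanPoitouTate)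
    [NeZero p] (hp5 : 5 ≤ p) (hr1 : W.analyticRank = 1)
    (V : WeierstrassCurve ℚ) [V.IsElliptic] [V.IsGloballyMinimal] (C : VariableChange ℚ)
    (hC : C • W.quadraticTwist ((-1) ^ (p / 2) * p) = V)
    (hgood : V.HasGoodReductionAtPrime p) (hap : V.frobeniusTrace p = 0)
    (hns : ¬ ∀ m : ℕ, V.HasSurjectiveModNGaloisRep (p ^ m : ℕ))
    (hX : ∀ {N : ℕ} [NeZero N] {f : CuspForm (Gamma0 N) 2}, IsNewformOf V f →
      ∀ (ϖ : ℚ), (if Even (p / 2) then (ϖ : ℝ) * V.realPeriodRat = plusPeriod f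
          else (ϖ : ℝ) * V.imaginaryPeriodRat = minusPeriod f) →
      ∀ (Lη : IwasawaAlgebra p), IsQuadraticBranchPlusLFunction f p ϖ Lη →
        Ideal.span {Lη} = Ideal.span {(PowerSeries.X : IwasawaAlgebra p)})
    (hP : haveI : NumberField (W.divisionField p) := NumberField.mk
      ∃ P : geomTorsion W (p : ℤ), P ≠ 0 ∧
        ∀ K : IntermediateField ℚ (W.divisionField p),
          K = IntermediateField.fixedField
            ((MulAction.stabilizer (absoluteGaloisGroup ℚ) P).map (absRestrictNormalHom (W.divisionField p))) →
        ∀ μ : Additive (ClassGroup (𝓞 K)) →+ ZMod p,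
          (∀ (τ : absoluteGaloisGroup ℚ) (σ : K ≃ₐ[ℚ] K) (a : ℕ),
              (∀ x : K, absRestrictNormalHom (W.divisionField p) τ (x : W.divisionField p) =
                ((σ x : K) : W.divisionField p)) → τ • P = a • P →
              ∀ (I J : (Ideal (𝓞 K))⁰),
                (J : Ideal (𝓞 K)) = (I : Ideal (𝓞 K)).map (AmbiguousClass.intAut σ : 𝓞 K →+* 𝓞 K) →
                μ (Additive.ofMul (ClassGroup.mk0 J)) = a • μ (Additive.ofMul (ClassGroup.mk0 I))) →
          (∀ (τ τ₁ : absoluteGaloisGroup ℚ) (a a₁ b : ℕ) (Q : geomTorsion W (p : ℤ)),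
              τ • P = a • P + Q → τ₁ • P = a₁ • P → τ₁ • Q = b • Q → (a₁ : ZMod p) ≠ (b : ZMod p) →
              ∀ I : (Ideal (𝓞 K))⁰,
                μ (Additive.ofMul (classGroupNorm K (W.divisionField p) (ClassGroup.mulEquiv
                  (AmbiguousClass.intAut (absRestrictNormalHom (W.divisionField p) τ))
                    (classGroupExtend K (W.divisionField p) (ClassGroup.mk0 I))))) =
                  (Nat.card ((W.divisionField p) ≃ₐ[K] (W.divisionField p)) * a) •
                    μ (Additive.ofMul (ClassGroup.mk0 I))) →
          μ = 0)
    (hcc1 : QuadraticBranchMinusLeadingValuationAt W p 0) :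
    BSDp W p :=
  bsdp_of_plusEtaMainConjectureAt_of_analyticRank_eq_one W p hGZK hmod hnf hM h12 hKO hGZ h74 hp5 V C hC hgood hap
    (EtaConjADoorHeckeRecords.etaMC_r1_of_heckeEigenHom h22 h41 h6273 hGZK p hp5 W hr1 V C hC hgood hap hns hX hP) hr1 hcc1

end Summit.BirchSwinnertonDyer.BirchSwinnertonDyer.Theorems.EtaConjADoorBSDRankOne

end
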